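import Summits.RiemannHypothesis.RiemannHypothesis.Theorems.Splittings.NbCoefficientLock
import HarnessLib

/-!
# RH-EQUIVALENT·SPLITTING CENSUS (nb, neg) · V36 «MÖBIUS LOCK», file 2/2: the second coefficient of budgeted Nyman–Beurling approximants is locked to `μ(2) = -1`, effectively and without any zero of `ζ`; «`a_1` off `-1`» and «`Re a_1 ≥ 0`» are refuted for every budget; nothing here bears on the truth of RH

LABEL (line 1): RH-EQUIVALENT·SPLITTING (cell `rh-split`, seat (nb, neg), generation 11, census
candidate V36, part B continued).  Referee carve (rh-split-ref g6) of the seat's kernel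
`HOME/rh-split-nb-neg/g11/NbCoefficientLock.lean` sha16 7262c60074fdb91d (618 l; farm rc 0 in the
combined replay, standard axioms) inside its §3 (after `dirichletPoly_nat_split_two`) for the gate's
≤ 400-line rule; declaration text byte-verbatim, same namespace `…Splittings.NbCoefficientLock`;
deltas = imports, this docstring.

## Contents (zero definitions, standard axioms, no zero of `ζ` used; `K(x) = x²(x+1)²/((x-1/2)(x-1))`)

* LOCK-1 `norm_constCoeff_add_secondCoeff_le (a : Fin (N+2) → ℂ) (hM : ∀ n, ‖a n‖ ≤ M) … (hk : 4 ≤ k) :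
  ‖a 0 + a 1‖ ≤ 2^k·√i·(K(k) + K(2k)) + 10·M·(2/3)^k` — with LOCK-0 (file 1) this forces `a_1 → -1 = μ(2)`
  along budgeted approximants with `I → 0` (the induction step of Báez-Duarte's inevitability lemma,
  arXiv:math/0011254 Lemma 4.2, made effective and zero-free on the Dirichlet-polynomial side).
* `not_nbSecondCoeffBddApprox (M δ) (hδ : 0 < δ)` — the conjunct «budgeted approximants with
  `‖a_1 + 1‖ ≥ δ`, ∀ε» is REFUTED for every budget `M` and every `δ > 0`.
* `not_nbPosReSecondCoeffBddApprox (M)` — the WRONG SIGN at `n = 2` (`Re a_1 ≥ 0`) is REFUTED for every budget.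
  Each conjunct trivially implies `NbThesis`, so as a splitting conjunct it was RH-PLUS; here it is false outright.

Certifies nothing about RH.

HONEST LABEL: «SPLITTING SEARCH over kernel-typed RH-EQUIVALENCES; a splitting A ∧ B ⟹ RH is
CONDITIONAL bookkeeping unless A and B are both proved; nothing here bears on the truth of RH.»
-/

set_option linter.dupNamespace false

noncomputable section

open Complex MeasureTheory Filter Topology
open scoped Real ComplexConjugate

namespace Summit.RiemannHypothesis.RiemannHypothesis.Theorems.Splittings.NbCoefficientLock

open Literature.NumberTheory.LFunctions
open Summit.RiemannHypothesis.RiemannHypothesis.Theorems.Splittings.NbBddNatural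
open Summit.RiemannHypothesis.RiemannHypothesis.Theorems.Splittings.NbCoefficientSign
open Summit.RiemannHypothesis.RiemannHypothesis.Theses.NymanBeurling

/-- **EFFECTIVE LOCK OF THE SECOND COEFFICIENT (V36, zero-free).** If `‖a_n‖ ≤ M` for all `n` and
`I(N+2, a) ≤ i`, then for every natural `k ≥ 4`
`‖a_0 + a_1‖ ≤ 2^k·√i·(K(k) + K(2k)) + 10·M·(2/3)^k`, `K(x) = x²(x+1)²/((x-1/2)(x-1))`;
with `norm_constCoeff_sub_one_le` this forces `a_1 → -1 = μ(2)` along approximants with bounded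
coefficients — the induction step of Báez-Duarte's inevitability lemma (arXiv:math/0011254,
Lemma 4.2) made effective and zero-free on the Dirichlet-polynomial side. -/
theorem norm_constCoeff_add_secondCoeff_le {N : ℕ} (a : Fin (N + 2) → ℂ) {M : ℝ}
    (hM : ∀ n, ‖a n‖ ≤ M) {i : ℝ} (hi : 0 ≤ i)
    (hI : ∫⁻ t : ℝ, ENNReal.ofReal (‖1 - riemannZeta (1 / 2 + t * Complex.I) *
        ∑ n : Fin (N + 2), a n * ((n : ℂ) + 1) ^ (-(1 / 2 + t * Complex.I))‖ ^ 2 / (1 / 4 + t ^ 2)) ≤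
      ENNReal.ofReal i) {k : ℕ} (hk : 4 ≤ k) :
    ‖a 0 + a 1‖ ≤ 2 ^ k * Real.sqrt i *
        ((k : ℝ) ^ 2 * ((k : ℝ) + 1) ^ 2 / (((k : ℝ) - 1 / 2) * ((k : ℝ) - 1)) +
          (2 * k : ℝ) ^ 2 * ((2 * k : ℝ) + 1) ^ 2 / (((2 * k : ℝ) - 1 / 2) * ((2 * k : ℝ) - 1))) +
      10 * M * (2 / 3) ^ k := by
  obtain ⟨τ, hζ, hτ0, hτle, hτsum⟩ := zeta_nat_eq_one_add_add_tail hk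
  obtain ⟨-, -, -, hz4u⟩ := zeta_two_four_window
  have hM0 : 0 ≤ M := (norm_nonneg _).trans (hM 0)
  have hkR : (1 : ℝ) < (k : ℝ) := by exact_mod_cast (show 1 < k by omega)
  have hs0 : 0 ≤ Real.sqrt i := Real.sqrt_nonneg i
  -- first-coefficient lock at the point `2k`
  have h2k : 4 ≤ 2 * k := by omega
  have hlock0 := norm_constCoeff_sub_one_le a hM hi hI h2k
  push_cast at hlock0
  -- the real-point bound at `x = k`
  have hpt := norm_one_sub_zeta_mul_dirichletPoly_le_real a hi hI hkR
  rw [Complex.ofReal_natCast] at hpt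
  set K : ℝ := (k : ℝ) ^ 2 * ((k : ℝ) + 1) ^ 2 / (((k : ℝ) - 1 / 2) * ((k : ℝ) - 1)) with hKdef
  set K2 : ℝ := (2 * k : ℝ) ^ 2 * ((2 * k : ℝ) + 1) ^ 2 / (((2 * k : ℝ) - 1 / 2) * ((2 * k : ℝ) - 1))
    with hK2def
  have hK0 : 0 ≤ K := by
    rw [hKdef]; apply div_nonneg (by positivity); apply mul_nonneg <;> linarith
  -- split `A(k) = a_0 + a_1 q + T₂`, `q = 2^{-k}`
  set q : ℂ := ((2 : ℂ) ^ k)⁻¹ with hqdef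
  set T : ℂ := ∑ j : Fin N, a j.succ.succ * ((((j : ℕ) : ℂ) + 3) ^ k)⁻¹ with hTdef
  have hA : dirichletPoly a (k : ℂ) = a 0 + a 1 * q + T := by
    rw [dirichletPoly_nat_split_two, hqdef, hTdef]
  -- norms of the pieces
  have hqn : ‖q‖ = ((2 : ℝ) ^ k)⁻¹ := by rw [hqdef, norm_inv, norm_pow, Complex.norm_two]
  have hT : ‖T‖ ≤ M * τ := by
    calc ‖T‖ ≤ ∑ j : Fin N, ‖a j.succ.succ * ((((j : ℕ) : ℂ) + 3) ^ k)⁻¹‖ := norm_sum_le _ _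
      _ ≤ ∑ j : Fin N, M * (1 / (((j : ℕ) : ℝ) + 3) ^ k) := by
          refine Finset.sum_le_sum fun j _ ↦ ?_
          have h3 : ‖(((j : ℕ) : ℂ) + 3) ^ k‖ = (((j : ℕ) : ℝ) + 3) ^ k := by
            have : (((j : ℕ) : ℂ) + 3) = ((((j : ℕ) : ℝ) + 3 : ℝ) : ℂ) := by push_cast; ring
            rw [norm_pow, this, Complex.norm_real, Real.norm_of_nonneg (by positivity)]
          rw [norm_mul, norm_inv, h3, ← one_div]
          exact mul_le_mul_of_nonneg_right (hM _) (by positivity)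
      _ = M * ∑ j : Fin N, 1 / (((j : ℕ) : ℝ) + 3) ^ k := by rw [Finset.mul_sum]
      _ ≤ M * τ := by
          refine mul_le_mul_of_nonneg_left ?_ hM0
          rw [Fin.sum_univ_eq_sum_range (fun j ↦ 1 / ((j : ℝ) + 3) ^ k) N]
          exact sum_le_hasSum _ (fun j _ ↦ by positivity) hτsum
  have hζq : riemannZeta k = 1 + q + τ := by rw [hζ, hqdef, one_div]
  -- the identity `q (a_0 + a_1) = (ζA - 1) - (a_0 - 1) - R`
  have hid : q * (a 0 + a 1) = -(1 - riemannZeta k * dirichletPoly a k) - (a 0 - 1) -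
      (a 1 * q * q + (τ : ℂ) * (a 0 + a 1 * q) + (1 + q + τ) * T) := by
    rw [hA, hζq]; ring
  set qr : ℝ := ((2 : ℝ) ^ k)⁻¹ with hqrdef
  have hqr0 : 0 < qr := by positivity
  have hqr1 : qr ≤ 1 / 16 := by
    rw [hqrdef, one_div]
    apply inv_anti₀ (by norm_num)
    calc (16 : ℝ) = 2 ^ 4 := by norm_num
      _ ≤ 2 ^ k := pow_le_pow_right₀ (by norm_num) hk
  have hτn : ‖(τ : ℂ)‖ = τ := by rw [Complex.norm_real, Real.norm_of_nonneg hτ0]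
  have h1qτ : ‖1 + q + (τ : ℂ)‖ ≤ 1 + qr + τ := by
    calc ‖1 + q + (τ : ℂ)‖ ≤ ‖(1 : ℂ)‖ + ‖q‖ + ‖(τ : ℂ)‖ := norm_add₃_le
      _ = 1 + qr + τ := by rw [norm_one, hqn, hτn]
  have hR : ‖a 1 * q * q + (τ : ℂ) * (a 0 + a 1 * q) + (1 + q + τ) * T‖ ≤
      M * qr * qr + τ * (M + M * qr) + (1 + qr + τ) * (M * τ) := by
    calc ‖a 1 * q * q + (τ : ℂ) * (a 0 + a 1 * q) + (1 + q + τ) * T‖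
        ≤ ‖a 1 * q * q‖ + ‖(τ : ℂ) * (a 0 + a 1 * q)‖ + ‖(1 + q + τ) * T‖ := norm_add₃_le
      _ ≤ M * qr * qr + τ * (M + M * qr) + (1 + qr + τ) * (M * τ) := by
          rw [norm_mul, norm_mul, norm_mul, norm_mul, hqn, hτn]
          gcongr
          · exact hM 1
          · calc ‖a 0 + a 1 * q‖ ≤ ‖a 0‖ + ‖a 1 * q‖ := norm_add_le _ _
              _ ≤ M + M * qr := by
                  rw [norm_mul, hqn]; gcongr
                  · exact hM 0
                  · exact hM 1
  have hmain : qr * ‖a 0 + a 1‖ ≤ Real.sqrt i * K + ‖a 0 - 1‖ +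
      (M * qr * qr + τ * (M + M * qr) + (1 + qr + τ) * (M * τ)) := by
    have := congrArg (fun z : ℂ ↦ ‖z‖) hid
    simp only [norm_mul, hqn] at this
    rw [this]
    calc ‖-(1 - riemannZeta k * dirichletPoly a k) - (a 0 - 1) -
          (a 1 * q * q + (τ : ℂ) * (a 0 + a 1 * q) + (1 + q + τ) * T)‖
        ≤ ‖-(1 - riemannZeta k * dirichletPoly a k)‖ + ‖a 0 - 1‖ +
          ‖a 1 * q * q + (τ : ℂ) * (a 0 + a 1 * q) + (1 + q + τ) * T‖ := by
          apply (norm_sub_le _ _).trans; gcongr; exact norm_sub_le _ _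
      _ ≤ Real.sqrt i * K + ‖a 0 - 1‖ +
          (M * qr * qr + τ * (M + M * qr) + (1 + qr + τ) * (M * τ)) := by
          rw [norm_neg]; gcongr
  -- constants: `A = 2^k ≥ 16`, `θ = 3^{4-k}`, `ρ = (2/3)^k`, `Aθ = 81ρ`, `1 ≤ Aρ`
  set A : ℝ := (2 : ℝ) ^ k with hAdef
  have hA0 : 0 < A := by positivity
  have hA16 : 16 ≤ A := by
    calc (16 : ℝ) = 2 ^ 4 := by norm_num
      _ ≤ 2 ^ k := pow_le_pow_right₀ (by norm_num) hk
  have hq : qr = A⁻¹ := hqrdef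
  set θ : ℝ := (1 / 3 : ℝ) ^ (k - 4) with hθdef
  set ρ : ℝ := (2 / 3 : ℝ) ^ k with hρdef
  have hθ0 : 0 ≤ θ := by positivity
  have hρ0 : 0 ≤ ρ := by positivity
  have hAθ : A * θ = 81 * ρ := by
    have h := pow_add (1 / 3 : ℝ) (k - 4) 4
    rw [show k - 4 + 4 = k by omega] at h
    have h3 : θ = 81 * (1 / 3 : ℝ) ^ k := by rw [hθdef, h]; ring
    rw [h3, hAdef, hρdef, show (2 / 3 : ℝ) = 2 * (1 / 3) by norm_num, mul_pow]
    ring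
  have hAρ : 1 ≤ A * ρ := by
    rw [hAdef, hρdef, ← mul_pow]
    exact one_le_pow₀ (by norm_num)
  have h2k4 : (1 / 2 : ℝ) ^ (2 * k - 4) = 16 * (A⁻¹ * A⁻¹) := by
    have h := pow_add (1 / 2 : ℝ) (2 * k - 4) 4
    rw [show 2 * k - 4 + 4 = 2 * k by omega, pow_mul, show (1 / 2 : ℝ) ^ 2 = 1 / 4 by norm_num]
      at h
    have h4 : (1 / 4 : ℝ) ^ k = A⁻¹ * A⁻¹ := by
      rw [hAdef, ← inv_pow, ← mul_pow]; norm_num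
    have h16 : (1 / 2 : ℝ) ^ 4 = 1 / 16 := by norm_num
    rw [h16, h4] at h
    linarith
  -- `τ ≤ 0.0315 θ`, `τ ≤ 0.0315`
  have hc3 : π ^ 4 / 90 - 1 - 1 / 16 ≤ 0.0315 := by linarith
  have hτθ : τ ≤ 0.0315 * θ := hτle.trans (mul_le_mul_of_nonneg_right hc3 hθ0)
  have hθ1 : θ ≤ 1 := pow_le_one₀ (by norm_num) (by norm_num)
  have hτ1 : τ ≤ 0.0315 := by nlinarith
  -- unfold `qr = A⁻¹` and multiply the main inequality by `A`
  rw [hq] at hmain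
  rw [h2k4] at hlock0
  have hAA : A * A⁻¹ = 1 := mul_inv_cancel₀ hA0.ne'
  have hx : ‖a 0 + a 1‖ ≤ A * (Real.sqrt i * K) + A * ‖a 0 - 1‖ +
      (M * A⁻¹ + 2 * τ * M + 2 * (A * τ) * M + (A * τ) * M * τ) := by
    have h := mul_le_mul_of_nonneg_left hmain hA0.le
    rw [← mul_assoc, hAA, one_mul] at h
    refine h.trans (le_of_eq ?_)
    linear_combination (M * A⁻¹ + 2 * τ * M) * hAA
  have hy : A * ‖a 0 - 1‖ ≤ A * (Real.sqrt i * K2) + 16 / 5 * (M * A⁻¹) := by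
    have h := mul_le_mul_of_nonneg_left hlock0 hA0.le
    refine h.trans (le_of_eq ?_)
    linear_combination (16 / 5 * M * A⁻¹) * hAA
  -- each remainder term is `≤ const · M ρ`
  have hMA : M * A⁻¹ ≤ M * ρ := by
    refine mul_le_mul_of_nonneg_left ?_ hM0
    rw [inv_le_iff_one_le_mul₀ hA0]; linarith
  have hθρ : θ ≤ 5.0625 * ρ := by
    have h16θ : 16 * θ ≤ A * θ := mul_le_mul_of_nonneg_right hA16 hθ0
    rw [hAθ] at h16θ
    linarith
  have hτρ : τ ≤ 0.1595 * ρ := hτθ.trans (by linarith)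
  have hAτ : A * τ ≤ 2.5515 * ρ := by
    calc A * τ ≤ A * (0.0315 * θ) := mul_le_mul_of_nonneg_left hτθ hA0.le
      _ = 0.0315 * (A * θ) := by ring
      _ = 2.5515 * ρ := by rw [hAθ]; ring
  have ht2 : 2 * τ * M ≤ 0.319 * (M * ρ) := by
    have h := mul_le_mul_of_nonneg_right hτρ hM0
    have e1 : 2 * τ * M = 2 * (τ * M) := by ring
    have e2 : (0.319 : ℝ) * (M * ρ) = 2 * (0.1595 * ρ * M) := by ring
    rw [e1, e2]
    linarith
  have ht3 : 2 * (A * τ) * M ≤ 5.103 * (M * ρ) := by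
    have h := mul_le_mul_of_nonneg_right hAτ hM0
    have e1 : 2 * (A * τ) * M = 2 * (A * τ * M) := by ring
    have e2 : (5.103 : ℝ) * (M * ρ) = 2 * (2.5515 * ρ * M) := by ring
    rw [e1, e2]
    linarith
  have ht4 : (A * τ) * M * τ ≤ 0.0804 * (M * ρ) := by
    have h1 : (A * τ) * M ≤ 2.5515 * ρ * M := mul_le_mul_of_nonneg_right hAτ hM0
    have h2 : (A * τ) * M * τ ≤ 2.5515 * ρ * M * τ := mul_le_mul_of_nonneg_right h1 hτ0
    have h3 : 2.5515 * ρ * M * τ ≤ 2.5515 * ρ * M * 0.0315 :=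
      mul_le_mul_of_nonneg_left hτ1 (by positivity)
    have e3 : (2.5515 : ℝ) * ρ * M * 0.0315 = 0.08037225 * (M * ρ) := by ring
    have hw0 : 0 ≤ M * ρ := mul_nonneg hM0 hρ0
    linarith
  have hKK : A * (Real.sqrt i * K) + A * (Real.sqrt i * K2) = A * Real.sqrt i * (K + K2) := by
    ring
  have hw0 : 0 ≤ M * ρ := mul_nonneg hM0 hρ0
  have hgoal : (10 : ℝ) * M * ρ = 10 * (M * ρ) := by ring
  rw [hgoal]
  linarith [hx, hy, hMA, ht2, ht3, ht4, hKK, hw0]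

/-- **V36 conjunct «WRONG μ(2) under budget» REFUTED (zero-free, effective).** For every budget
`M` and every `δ > 0` it is NOT the case that for every `ε > 0` some Dirichlet polynomial with
`‖a_n‖ ≤ M ∀ n` and second coefficient at distance `≥ δ` from `μ(2) = -1` (e.g. `a_1 = 0`, or
`Re a_1 ≥ 0`: the WRONG SIGN at `n = 2`) has `I < ε`. -/
theorem not_nbSecondCoeffBddApprox (M δ : ℝ) (hδ : 0 < δ) :
    ¬ (∀ ε : ℝ, 0 < ε → ∃ (N : ℕ) (a : Fin (N + 2) → ℂ), (∀ n, ‖a n‖ ≤ M) ∧ δ ≤ ‖a 1 + 1‖ ∧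
      ∫⁻ t : ℝ, ENNReal.ofReal (‖1 - riemannZeta (1 / 2 + t * Complex.I) *
        ∑ n : Fin (N + 2), a n * ((n : ℂ) + 1) ^ (-(1 / 2 + t * Complex.I))‖ ^ 2 / (1 / 4 + t ^ 2)) <
      ENNReal.ofReal ε) := by
  intro h
  -- the budget is nonnegative (else the conjunct is already empty)
  by_cases hM0 : 0 ≤ M
  swap
  · obtain ⟨N, a, hM, -, -⟩ := h 1 one_pos
    exact hM0 ((norm_nonneg _).trans (hM 0))
  -- choose the evaluation point `k`
  obtain ⟨n₁, hn₁⟩ := exists_pow_lt_of_lt_one (show 0 < δ / (40 * M + 1) by positivity)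
    (show (2 / 3 : ℝ) < 1 by norm_num)
  obtain ⟨n₂, hn₂⟩ := exists_pow_lt_of_lt_one (show 0 < δ / (M + 1) by positivity)
    (show (1 / 2 : ℝ) < 1 by norm_num)
  set k : ℕ := n₁ + n₂ + 4 with hkdef
  have hk : 4 ≤ k := by omega
  have hρ : (2 / 3 : ℝ) ^ k ≤ (2 / 3) ^ n₁ :=
    pow_le_pow_of_le_one (by norm_num) (by norm_num) (by omega)
  have hr : (1 / 2 : ℝ) ^ (k - 4) ≤ (1 / 2) ^ n₂ := by
    rw [show k - 4 = n₁ + n₂ by omega]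
    exact pow_le_pow_of_le_one (by norm_num) (by norm_num) (by omega)
  -- the constants at `k`
  have hk4 : (4 : ℝ) ≤ (k : ℝ) := by exact_mod_cast hk
  set K : ℝ := (k : ℝ) ^ 2 * ((k : ℝ) + 1) ^ 2 / (((k : ℝ) - 1 / 2) * ((k : ℝ) - 1)) with hKdef
  set K2 : ℝ := (2 * k : ℝ) ^ 2 * ((2 * k : ℝ) + 1) ^ 2 / (((2 * k : ℝ) - 1 / 2) * ((2 * k : ℝ) - 1))
    with hK2def
  have hK : 0 < K := by
    rw [hKdef]; apply div_pos (by positivity); apply mul_pos <;> linarith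
  have hK2 : 0 < K2 := by
    rw [hK2def]; apply div_pos (by positivity); apply mul_pos <;> linarith
  set A : ℝ := (2 : ℝ) ^ k with hAdef
  have hA : 0 < A := by positivity
  set L : ℝ := A * (K + K2) + K + 1 with hLdef
  have hL : 0 < L := by positivity
  set ε : ℝ := (δ / (8 * L)) ^ 2 with hεdef
  have hε : 0 < ε := by positivity
  obtain ⟨N, a, hM, hδa, hlt⟩ := h ε hε
  have hsq : Real.sqrt ε = δ / (8 * L) := by rw [hεdef, Real.sqrt_sq (by positivity)]
  have h01 : ‖a 0 + a 1‖ ≤ A * (δ / (8 * L)) * (K + K2) + 10 * M * (2 / 3) ^ k := by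
    have h' := norm_constCoeff_add_secondCoeff_le a hM hε.le hlt.le hk
    rw [hsq] at h'
    exact h'
  have h0 : ‖a 0 - 1‖ ≤ δ / (8 * L) * K + M * (1 / 2) ^ (k - 4) / 5 := by
    have h' := norm_constCoeff_sub_one_le a hM hε.le hlt.le hk
    rw [hsq] at h'
    exact h'
  -- the four small terms
  have b1 : A * (δ / (8 * L)) * (K + K2) ≤ δ / 8 := by
    have hle : A * (K + K2) ≤ L := by rw [hLdef]; linarith
    have e : A * (δ / (8 * L)) * (K + K2) = δ / 8 * (A * (K + K2) / L) := by
      field_simp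
    rw [e]
    have hfrac : A * (K + K2) / L ≤ 1 := (div_le_one hL).mpr hle
    nlinarith
  have b2 : δ / (8 * L) * K ≤ δ / 8 := by
    have hle : K ≤ L := by rw [hLdef]; nlinarith
    have e : δ / (8 * L) * K = δ / 8 * (K / L) := by field_simp
    rw [e]
    have hfrac : K / L ≤ 1 := (div_le_one hL).mpr hle
    nlinarith
  have b3 : 10 * M * (2 / 3 : ℝ) ^ k < δ / 4 := by
    have hn : (2 / 3 : ℝ) ^ n₁ * (40 * M + 1) < δ := by
      rwa [lt_div_iff₀ (by positivity : (0 : ℝ) < 40 * M + 1)] at hn₁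
    have s1 : 10 * M * (2 / 3 : ℝ) ^ k ≤ 10 * M * (2 / 3) ^ n₁ :=
      mul_le_mul_of_nonneg_left hρ (by positivity)
    have s2 : 10 * M * (2 / 3 : ℝ) ^ n₁ ≤ (40 * M + 1) / 4 * (2 / 3) ^ n₁ :=
      mul_le_mul_of_nonneg_right (by linarith) (by positivity)
    have s3 : (40 * M + 1) / 4 * (2 / 3 : ℝ) ^ n₁ = (2 / 3) ^ n₁ * (40 * M + 1) / 4 := by ring
    linarith
  have b4 : M * (1 / 2 : ℝ) ^ (k - 4) / 5 < δ / 5 := by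
    have hn : (1 / 2 : ℝ) ^ n₂ * (M + 1) < δ := by
      rwa [lt_div_iff₀ (by positivity : (0 : ℝ) < M + 1)] at hn₂
    have s1 : M * (1 / 2 : ℝ) ^ (k - 4) ≤ M * (1 / 2) ^ n₂ := mul_le_mul_of_nonneg_left hr hM0
    have s2 : M * (1 / 2 : ℝ) ^ n₂ ≤ (M + 1) * (1 / 2) ^ n₂ :=
      mul_le_mul_of_nonneg_right (by linarith) (by positivity)
    have s3 : (M + 1) * (1 / 2 : ℝ) ^ n₂ = (1 / 2) ^ n₂ * (M + 1) := mul_comm _ _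
    linarith
  -- triangle inequality
  have htri : ‖a 1 + 1‖ ≤ ‖a 0 + a 1‖ + ‖a 0 - 1‖ := by
    calc ‖a 1 + 1‖ = ‖(a 0 + a 1) - (a 0 - 1)‖ := by ring_nf
      _ ≤ ‖a 0 + a 1‖ + ‖a 0 - 1‖ := norm_sub_le _ _
  linarith

/-- **WRONG SIGN AT `n = 2` under budget — REFUTED.** Approximants with `‖a_n‖ ≤ M` and
`Re a_1 ≥ 0` (the coefficient of `2^{-s}` in the closed right half-plane, where `μ(2) = -1`
lies at distance `1`) cannot reach `I < ε(M)`. -/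
theorem not_nbPosReSecondCoeffBddApprox (M : ℝ) :
    ¬ (∀ ε : ℝ, 0 < ε → ∃ (N : ℕ) (a : Fin (N + 2) → ℂ), (∀ n, ‖a n‖ ≤ M) ∧ 0 ≤ (a 1).re ∧
      ∫⁻ t : ℝ, ENNReal.ofReal (‖1 - riemannZeta (1 / 2 + t * Complex.I) *
        ∑ n : Fin (N + 2), a n * ((n : ℂ) + 1) ^ (-(1 / 2 + t * Complex.I))‖ ^ 2 / (1 / 4 + t ^ 2)) <
      ENNReal.ofReal ε) := by
  intro h
  apply not_nbSecondCoeffBddApprox M 1 one_pos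
  intro ε hε
  obtain ⟨N, a, hM, hre, hlt⟩ := h ε hε
  refine ⟨N, a, hM, ?_, hlt⟩
  calc (1 : ℝ) ≤ (a 1 + 1).re := by simp; linarith
    _ ≤ ‖a 1 + 1‖ := Complex.re_le_norm _

end Summit.RiemannHypothesis.RiemannHypothesis.Theorems.Splittings.NbCoefficientLock
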